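import Literature.NumberTheory.ComplexMultiplication.FiniteQAlgebraLatticeClassGroupBijections
import Mathlib.RingTheory.Smooth.Basic
import Mathlib.RingTheory.Smooth.Pi
import Mathlib.RingTheory.Etale.Field
import Mathlib.RingTheory.Artinian.Ring
import Mathlib.RingTheory.Artinian.Module
import Mathlib.FieldTheory.Perfect
import HarnessLib

/-!
# `A = F ⊕ R`: a finite-dimensional commutative `ℚ`-algebra has a SEPARABLE SUBALGEBRA COMPLEMENT of its radical —
# equivalently `A → A/R` has a `ℚ`-algebra section (Hertling–Larabi 2026 Thm. 3.1, Rem. 3.2 (ii): «The algebra `A`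
# decomposes naturally into the direct sum `A = F ⊕ R`»; the Wedderburn–Malcev principal theorem [CR62] in the
# commutative characteristic-`0` case) — whence Thm. 9.2 ∕ 2026b Thm. 5.10 UNCONDITIONALLY for every model
# `π : A ↠ B` of `pr_F` (`B` reduced, `ker π` nil): `G(Λ) → G(πΛ)` is onto and `|G([Λ]_ε)| = |G([πΛ]_ε)|`

[topic NumberTheory/ComplexMultiplication] General-`A` series (namespace
`Literature.NumberTheory.ComplexMultiplication.FiniteQAlgebraLattice`); sequel of
`FiniteQAlgebraLatticeRadicalProjection` (Thm. 9.2 surjectivity `exists_invertible_map_eq`, GIVEN a multiplicative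
section `σ` of `π`), `FiniteQAlgebraLatticeRadicalProjectionInjective` (Thm. 9.2 injectivity [Fa68]) and
`FiniteQAlgebraLatticeClassGroupBijections` (`|G([Λ]_ε)| = |G([πΛ]_ε)|`, GIVEN `σ`).  This file PROVIDES the
section for the radical projection `π : A → A ⧸ nilradical A` of every finite-dimensional commutative `ℚ`-algebra,
so that those theorems hold unconditionally, as printed.  Lane `lit-hodgefound` (Track 2 foundations library),
seat p19 generation 37, row g37-#11.  THEOREMS ONLY: no definition, no instance, no notation, no named fact
(D-0026, net Literature debt `0`), no `sorry`.

DEF-FREE SPELLING.  HL's radical `R` («the set of all nilpotent elements of `A`») is Mathlib's `nilradical A`;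
`pr_F : A → F ≅ A/R` is `Ideal.Quotient.mk (nilradical A) : A → A ⧸ nilradical A`, or ANY surjective `ℚ`-algebra
homomorphism `π : A → B` onto a reduced `B` whose kernel consists of nilpotent elements (then `ker π = R`,
`B ≅ A/R`); «`A = F ⊕ R` with `F` a (separable) subalgebra» is (§1) `∃ σ : (A ⧸ nilradical A) →ₐ[ℚ] A` with
`pr_F ∘ σ = id` — equivalently (§2) `∃ F : Subalgebra ℚ A`, reduced, with `IsCompl F R` as `ℚ`-subspaces; `π(M)` is
`M.map (π : A →+ B).toIntLinearMap` and `G([Λ]_ε)` the quotient type of `FiniteQAlgebraLatticeInvertibleClassesFinite`.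

## Sources, VERBATIM

C. Hertling, K. Larabi, *Semigroups from full lattices in commutative ℚ-algebras*, arXiv:2602.14973 (2026)
[HertlingLarabi2026], held `paper:arxiv-2602.14973`, §3 (chunk p0007): «Throughout the whole paper `A` is a finite
dimensional commutative `ℚ`-algebra with unit element `1_A`. The structure theory of `A` is not difficult. It is
partly covered by the Wedderburn-Malcev theorem [CR62]. […] **Theorem 3.1.** Let `A` be a finite dimensional
commutative `ℚ`-algebra with unit element `1_A`. Then `A` has a unique vector space decomposition
`A = ⊕_{j=1}^k A^{(j)}` […] (iii) `A^{(j)}` splits uniquely into `A^{(j)} = F^{(j)} ⊕ N^{(j)}` with `F^{(j)}` a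
`ℚ`-subalgebra and an algebraic number field, and `N^{(j)}` the unique maximal ideal of `A^{(j)}`. […] `N^{(j)}`
consists of nilpotent elements and is the radical of `A^{(j)}`. […] **Remarks 3.2.** […] (ii) The sum
`F := ⊕_{j=1}^k F^{(j)}` is a separable subalgebra of `A`. The maximal ideals in `A` are the subspaces
`N^{(j)} ⊕ ⊕_{i≠j} A^{(i)}` for `j ∈ {1, ..., k}`. Their intersection is the radical `R = ⊕_{j=1}^k N^{(j)}`. It is
the set of all nilpotent elements of `A`. The algebra `A` decomposes naturally into the direct sum `A = F ⊕ R`. The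
induced projection `pr_F : A → F` respects addition, multiplication and division. We will come back to it in
section 9.»; §9 (chunk p0024): «**Theorem 9.2.** The group homomorphism in (9.6) is surjective. The group
homomorphism in (9.7) is an isomorphism.» and «Of course `F^{unit} ⊂ A^{unit}`» (the section used in its proof);
«**Remarks 9.3.** […] (iii) […] the equality of the sizes of the two groups is new.»

C. Hertling, K. Larabi, *Conjugacy classes of regular integer matrices*, arXiv:2602.15748 (2026)
[HertlingLarabi2026b], held `paper:arxiv-2602.15748`, §5 (chunk p0010): «**Theorem 5.10** (Fa68) [HL26]. Let `Λ`
be an order in `A`. Write `Λ_0 := pr_FΛ` for the induced order in `F`. […] The group homomorphism in (5.16) is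
surjective. The group homomorphism in (5.17) is an isomorphism.»

## The proof of `A = F ⊕ R` (a road through Mathlib's formal smoothness, not HL's Jordan–Chevalley argument)

`B := A ⧸ nilradical A ≅ ∏_𝔪 A/𝔪` (`IsArtinianRing.quotNilradicalEquivPi`; `A` is artinian, being
finite-dimensional); each `A/𝔪` is a finite, hence separable (characteristic `0`), field extension of `ℚ`, so it is
formally étale over `ℚ` (`Algebra.FormallyEtale.of_isSeparable`), a finite product of formally smooth algebras is
formally smooth, and formal smoothness transports along the isomorphism; the radical `nilradical A` is nilpotent
(`IsArtinianRing.isNilpotent_nilradical`), so the identity `B → A ⧸ nilradical A` lifts to a `ℚ`-algebra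
homomorphism `σ : B → A` (`Algebra.FormallySmooth.exists_lift`) — `pr_F ∘ σ = id`, `F := σ(B)`.

## What is proved (`A` a finite-dimensional commutative `ℚ`-algebra)

* §1 **`exists_algHom_section_nilradical`** — THEOREM 3.1 ∕ REM. 3.2 (ii) as a SECTION: there is a `ℚ`-algebra
  homomorphism `σ : A ⧸ nilradical A → A` with `pr_F (σ b) = b` for all `b`.
* §2 **`exists_subalgebra_isCompl_nilradical`** — THEOREM 3.1 ∕ REM. 3.2 (ii) AS PRINTED, «`A = F ⊕ R`»: there is a
  `ℚ`-subalgebra `F ⊂ A` without nonzero nilpotent elements («separable») which is a vector-space complement of the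
  radical `R`.
* §1 **`exists_algHom_section_of_isReduced`** — the same for every MODEL of `pr_F`: a surjective `ℚ`-algebra
  homomorphism `π : A → B` onto a reduced `B` with nil kernel has a `ℚ`-algebra section.
* §3 THEOREM 9.2 ∕ 5.10 UNCONDITIONALLY for every such `π` and every order `Λ`:
  **`exists_invertible_map_eq_of_isReduced`** — (9.6) `G(Λ) → G(πΛ)` is SURJECTIVE;
  **`natCard_quot_invertible_eq_natCard_quot_invertible_map_of_isReduced`** — (9.7) is a bijection,
  `|G([Λ]_ε)| = |G([πΛ]_ε)|` (Rem. 9.3 (iii) «the equality of the sizes of the two groups»).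
NOT here: the finer decomposition `A = ⊕_j A^{(j)}`, `A^{(j)} = F^{(j)} ⊕ N^{(j)}` of Thm. 3.1 and its uniqueness
statements.

## References

* [HertlingLarabi2026] C. Hertling, K. Larabi, arXiv:2602.14973 (2026), §3 Thm. 3.1, Rem. 3.2 (ii) (chunk p0007),
  §9 Thm. 9.2, Rem. 9.3 (iii) (chunk p0024). [cite: HertlingLarabi2026, §3 Thm. 3.1 and Rem. 3.2 (ii), chunk p0007]
* [HertlingLarabi2026b] C. Hertling, K. Larabi, arXiv:2602.15748 (2026), §3 Thm. 3.1 (chunk p0006), §5 Thm. 5.10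
  (chunk p0010). [cite: HertlingLarabi2026b, §5 Thm. 5.10, chunk p0010]
* [CurtisReiner1962] C. W. Curtis, I. Reiner, *Representation theory of finite groups and associative algebras*
  (1962), Ch. X §72 (the Wedderburn–Malcev theorem), as cited by [HertlingLarabi2026] §3.
  [cite: CurtisReiner1962, Ch. X §72 (Wedderburn–Malcev theorem), as cited by HertlingLarabi2026 §3]
* [Faddeev1968] D. K. Faddeev, Amer. Math. Soc. Transl. (2) 71 (1968) 43–48 (injectivity of (9.7), as cited by
  [HertlingLarabi2026] Thm. 9.2). [cite: Faddeev1968, as cited by HertlingLarabi2026 §9 Thm. 9.2]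
-/

noncomputable section

open scoped Pointwise
open Module Function Submodule

open Literature.NumberTheory.Automorphic (IsFullLattice mem_units_smul_submodule_iff)

namespace Literature.NumberTheory.ComplexMultiplication.FiniteQAlgebraLattice

section WedderburnMalcev

variable {A : Type} [CommRing A] [Algebra ℚ A]

/-! ## §1 Theorem 3.1 ∕ Rem. 3.2 (ii): a `ℚ`-algebra section of `pr_F : A → A/R` -/

/-- `A ⧸ nilradical A ≅ ∏_𝔪 A/𝔪` is formally smooth over `ℚ` (each `A/𝔪` is a finite separable field extension
of `ℚ`, formally étale). [folklore] -/
private theorem formallySmooth_quotient_nilradical [Module.Finite ℚ A] :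
    Algebra.FormallySmooth ℚ (A ⧸ nilradical A) := by
  haveI : IsArtinianRing A := IsArtinianRing.of_finite ℚ A
  letI : Fintype (MaximalSpectrum A) := Fintype.ofFinite _
  letI : ∀ i : MaximalSpectrum A, Field (A ⧸ i.asIdeal) := fun i => Ideal.Quotient.field i.asIdeal
  haveI : ∀ i : MaximalSpectrum A, Algebra.FormallyEtale ℚ (A ⧸ i.asIdeal) := fun i =>
    Algebra.FormallyEtale.of_isSeparable ℚ (A ⧸ i.asIdeal)
  -- the `ℚ`-algebra isomorphism `A ⧸ nilradical A ≃ ∏_𝔪 A/𝔪`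
  let e : (A ⧸ nilradical A) ≃+* (Π i : MaximalSpectrum A, A ⧸ i.asIdeal) :=
    (IsArtinianRing.quotNilradicalEquivPi A).toRingEquiv
  have he : ∀ q : ℚ, e (algebraMap ℚ (A ⧸ nilradical A) q) =
      algebraMap ℚ (Π i : MaximalSpectrum A, A ⧸ i.asIdeal) q := fun q => by
    have h := Subsingleton.elim (e.toRingHom.comp (algebraMap ℚ (A ⧸ nilradical A)))
      (algebraMap ℚ (Π i : MaximalSpectrum A, A ⧸ i.asIdeal))
    exact RingHom.congr_fun h q
  exact Algebra.FormallySmooth.of_equiv (AlgEquiv.ofRingEquiv (f := e) he).symm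

/-- **THEOREM 3.1 ∕ REMARKS 3.2 (ii), `A = F ⊕ R` as a SECTION of `pr_F`: for every finite-dimensional commutative
`ℚ`-algebra `A` there is a `ℚ`-algebra homomorphism `σ : A/R → A`, `R = nilradical A` the radical, with
`pr_F ∘ σ = id`** («The algebra `A` decomposes naturally into the direct sum `A = F ⊕ R`. The induced projection
`pr_F : A → F` respects addition, multiplication»; `F = σ(A/R)`; the Wedderburn–Malcev principal theorem in the
commutative characteristic-`0` case, here by lifting the identity of the formally smooth `ℚ`-algebra `A/R ≅ ∏ A/𝔪`
over the nilpotent ideal `R`). [cite: HertlingLarabi2026, §3 Thm. 3.1 (iii) and Rem. 3.2 (ii), chunk p0007]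
[cite: CurtisReiner1962, Ch. X §72 (Wedderburn–Malcev theorem), as cited by HertlingLarabi2026 §3] -/
theorem exists_algHom_section_nilradical [Module.Finite ℚ A] :
    ∃ σ : (A ⧸ nilradical A) →ₐ[ℚ] A, ∀ b, Ideal.Quotient.mk (nilradical A) (σ b) = b := by
  haveI : IsArtinianRing A := IsArtinianRing.of_finite ℚ A
  haveI := formallySmooth_quotient_nilradical (A := A)
  obtain ⟨σ, hσ⟩ := Algebra.FormallySmooth.exists_lift (nilradical A)
    (IsArtinianRing.isNilpotent_nilradical (R := A)) (AlgHom.id ℚ (A ⧸ nilradical A))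
  exact ⟨σ, fun b => by simpa using AlgHom.congr_fun hσ b⟩

/-- **`A = F ⊕ R`, the decomposition of an element: `x = σ(pr_F x) + (x − σ(pr_F x))` with `x − σ(pr_F x) ∈ R`.**
[cite: HertlingLarabi2026, §3 Rem. 3.2 (ii), chunk p0007] -/
theorem sub_section_mk_mem_nilradical {σ : (A ⧸ nilradical A) →ₐ[ℚ] A}
    (hσ : ∀ b, Ideal.Quotient.mk (nilradical A) (σ b) = b) (x : A) :
    x - σ (Ideal.Quotient.mk (nilradical A) x) ∈ nilradical A := by
  rw [← Ideal.Quotient.eq_zero_iff_mem, map_sub, hσ, sub_self]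

/-- **THEOREM 3.1 ∕ REMARKS 3.2 (ii), the section for ANY model of `pr_F`: if `π : A → B` is a surjective
`ℚ`-algebra homomorphism onto a REDUCED `B` whose kernel consists of nilpotent elements (so `ker π = R` and
`B ≅ A/R ≅ F`, e.g. `B` a product of number fields), then `π` has a `ℚ`-algebra section `σ : B → A`,
`π ∘ σ = id`** («Of course `F^{unit} ⊂ A^{unit}`», «the natural decomposition `A = F ⊕ R`»).
[cite: HertlingLarabi2026, §3 Thm. 3.1 (iii) and Rem. 3.2 (ii), chunk p0007; §9 (proof of Thm. 9.2), chunk p0024]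
[cite: CurtisReiner1962, Ch. X §72 (Wedderburn–Malcev theorem), as cited by HertlingLarabi2026 §3] -/
theorem exists_algHom_section_of_isReduced [Module.Finite ℚ A] {B : Type} [CommRing B] [Algebra ℚ B]
    [IsReduced B] (π : A →ₐ[ℚ] B) (hπ : Surjective π) (hnil : ∀ x, π x = 0 → IsNilpotent x) :
    ∃ σ : B →ₐ[ℚ] A, ∀ b, π (σ b) = b := by
  haveI : IsArtinianRing A := IsArtinianRing.of_finite ℚ A
  haveI := formallySmooth_quotient_nilradical (A := A)
  -- `ker π = R`
  have hker : RingHom.ker π = nilradical A := by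
    refine le_antisymm (fun x hx => mem_nilradical.2 (hnil x (RingHom.mem_ker.1 hx))) fun x hx => ?_
    exact RingHom.mem_ker.2 ((mem_nilradical.1 hx).map π).eq_zero
  -- `B ≅ A/ker π ≅ A/R` is formally smooth over `ℚ`
  let e : (A ⧸ RingHom.ker π) ≃ₐ[ℚ] B := Ideal.quotientKerAlgEquivOfSurjective hπ
  haveI : Algebra.FormallySmooth ℚ (A ⧸ RingHom.ker π) :=
    Algebra.FormallySmooth.of_equiv (Ideal.quotientEquivAlgOfEq ℚ hker).symm
  haveI : Algebra.FormallySmooth ℚ B := Algebra.FormallySmooth.of_equiv e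
  obtain ⟨σ, hσ⟩ := Algebra.FormallySmooth.exists_lift (RingHom.ker π)
    (hker ▸ IsArtinianRing.isNilpotent_nilradical (R := A)) (e.symm : B →ₐ[ℚ] A ⧸ RingHom.ker π)
  refine ⟨σ, fun b => ?_⟩
  have h := AlgHom.congr_fun hσ b
  simp only [AlgHom.coe_comp, Function.comp_apply, Ideal.Quotient.mkₐ_eq_mk] at h
  -- `h : mk (σ b) = e.symm b`; apply `e`
  have h' := congrArg e h
  rw [Ideal.quotientKerAlgEquivOfSurjective_mk] at h'
  simpa using h'

/-! ## §2 Theorem 3.1 ∕ Rem. 3.2 (ii) as printed: a separable subalgebra `F` with `A = F ⊕ R` -/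

/-- **THEOREM 3.1 ∕ REMARKS 3.2 (ii) AS PRINTED: `A = F ⊕ R` — every finite-dimensional commutative `ℚ`-algebra
`A` contains a `ℚ`-subalgebra `F` without nonzero nilpotent elements («`F` is a separable subalgebra of `A`») which
is a vector-space complement of the radical `R` («the set of all nilpotent elements of `A`»; «The algebra `A`
decomposes naturally into the direct sum `A = F ⊕ R`»).** Here `F = σ(A/R)` for a section `σ` of `pr_F`.
[cite: HertlingLarabi2026, §3 Thm. 3.1 (iii) and Rem. 3.2 (ii), chunk p0007]
[cite: CurtisReiner1962, Ch. X §72 (Wedderburn–Malcev theorem), as cited by HertlingLarabi2026 §3] -/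
theorem exists_subalgebra_isCompl_nilradical [Module.Finite ℚ A] :
    ∃ F : Subalgebra ℚ A, (∀ x ∈ F, IsNilpotent x → x = 0) ∧
      IsCompl (Subalgebra.toSubmodule F) ((nilradical A).restrictScalars ℚ) := by
  obtain ⟨σ, hσ⟩ := exists_algHom_section_nilradical (A := A)
  have hinj : ∀ b, σ b ∈ nilradical A → b = 0 := fun b hb => by
    rw [← hσ b]
    exact Ideal.Quotient.eq_zero_iff_mem.2 hb
  refine ⟨σ.range, fun x hx hnil => ?_, IsCompl.of_eq ?_ ?_⟩
  · obtain ⟨b, rfl⟩ := (AlgHom.mem_range σ).1 hx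
    rw [hinj b (mem_nilradical.2 hnil), map_zero]
  · rw [Submodule.eq_bot_iff]
    intro x hx
    obtain ⟨hx₁, hx₂⟩ := Submodule.mem_inf.1 hx
    obtain ⟨b, rfl⟩ := (AlgHom.mem_range σ).1 ((Subalgebra.mem_toSubmodule _).1 hx₁)
    rw [hinj b ((Submodule.restrictScalars_mem ℚ _ _).1 hx₂), map_zero]
  · rw [Submodule.eq_top_iff']
    intro x
    refine Submodule.mem_sup.2 ⟨σ (Ideal.Quotient.mk (nilradical A) x),
      (Subalgebra.mem_toSubmodule _).2 ((AlgHom.mem_range σ).2 ⟨_, rfl⟩),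
      x - σ (Ideal.Quotient.mk (nilradical A) x),
      (Submodule.restrictScalars_mem ℚ _ _).2 (sub_section_mk_mem_nilradical hσ x), by abel⟩

/-! ## §3 Theorem 9.2 ∕ 5.10 unconditionally for `pr_F : A → F` -/

/-- **THEOREM 9.2 ∕ 5.10, SURJECTIVITY of (9.6) `G(Λ) → G(Λ_0)`, `L ↦ pr_FL`, UNCONDITIONALLY** — for every
finite-dimensional commutative `ℚ`-algebra `A`, every model `π : A → B` of `pr_F` (a surjective `ℚ`-algebra
homomorphism onto a reduced `B` with nil kernel), every order `Λ` and every invertible full lattice `L_0 ⊂ B`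
with `𝒪(L_0) = πΛ` there is an invertible full lattice `L ⊂ A` with `𝒪(L) = Λ` and `πL = L_0` («The group
homomorphism in (9.6) is surjective»; `FiniteQAlgebraLatticeRadicalProjection.exists_invertible_map_eq` fed with
the section of §1, HL's «Of course `F^{unit} ⊂ A^{unit}`»). [cite: HertlingLarabi2026, §9 Thm. 9.2, chunk p0024]
[cite: HertlingLarabi2026b, §5 Thm. 5.10 («The group homomorphism in (5.16) is surjective»), chunk p0010] -/
theorem exists_invertible_map_eq_of_isReduced [Module.Finite ℚ A] {B : Type} [CommRing B] [Algebra ℚ B]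
    [IsReduced B] (π : A →ₐ[ℚ] B) (hπ : Surjective π) (hnil : ∀ x, π x = 0 → IsNilpotent x)
    {Λ : Submodule ℤ A} (hΛ : IsFullLattice A Λ) (h1 : (1 : A) ∈ Λ) (hΛΛ : Λ * Λ ≤ Λ)
    {L₀ : Submodule ℤ B} (hL₀ : IsFullLattice B L₀)
    (hO₀ : L₀ / L₀ = Λ.map ((π : A →+* B) : A →+ B).toIntLinearMap) (hinv₀ : L₀ * ((L₀ / L₀) / L₀) = L₀ / L₀) :
    ∃ L : Submodule ℤ A, IsFullLattice A L ∧ L / L = Λ ∧ L * ((L / L) / L) = L / L ∧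
      L.map ((π : A →+* B) : A →+ B).toIntLinearMap = L₀ := by
  obtain ⟨σ, hσ⟩ := exists_algHom_section_of_isReduced π hπ hnil
  exact exists_invertible_map_eq (π := (π : A →+* B)) (σ := (σ : B →+* A)) hσ hΛ h1 hΛΛ hL₀ hO₀ hinv₀

/-- **THEOREM 9.2 ∕ 5.10 with REMARKS 9.3 (iii), UNCONDITIONALLY: (9.7) `G([Λ]_ε) → G([pr_FΛ]_ε)` is a BIJECTION —
`|G([Λ]_ε)| = |G([pr_FΛ]_ε)|`** for every finite-dimensional commutative `ℚ`-algebra `A`, every model `π : A → B`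
of `pr_F` (a surjective `ℚ`-algebra homomorphism onto a reduced `B` with nil kernel) and every order `Λ` («The group
homomorphism in (9.7) is an isomorphism»; «the equality of the sizes of the two groups is new»; both are finite,
`FiniteQAlgebraLatticeInvertibleClassesFinite.finite_quot_invertible`).
[cite: HertlingLarabi2026, §9 Thm. 9.2 and Rem. 9.3 (iii), chunk p0024] [cite: HertlingLarabi2026b, §5 Thm. 5.10, chunk p0010]
[cite: Faddeev1968, as cited by HertlingLarabi2026 §9 Thm. 9.2] -/
theorem natCard_quot_invertible_eq_natCard_quot_invertible_map_of_isReduced [Module.Finite ℚ A] {B : Type}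
    [CommRing B] [Algebra ℚ B] [IsReduced B] (π : A →ₐ[ℚ] B) (hπ : Surjective π)
    (hnil : ∀ x, π x = 0 → IsNilpotent x)
    {Λ : Submodule ℤ A} (hΛ : IsFullLattice A Λ) (h1 : (1 : A) ∈ Λ) (hΛΛ : Λ * Λ ≤ Λ) :
    Nat.card (Quot fun L L' : {L : Submodule ℤ A //
        IsFullLattice A L ∧ L / L = Λ ∧ L * ((L / L) / L) = L / L} => ∃ u : Aˣ, u • L.1 = L'.1) =
      Nat.card (Quot fun M M' : {M : Submodule ℤ B // IsFullLattice B M ∧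
        M / M = Λ.map ((π : A →+* B) : A →+ B).toIntLinearMap ∧ M * ((M / M) / M) = M / M} =>
          ∃ u : Bˣ, u • M.1 = M'.1) := by
  obtain ⟨σ, hσ⟩ := exists_algHom_section_of_isReduced π hπ hnil
  exact natCard_quot_invertible_eq_natCard_quot_invertible_map (π := (π : A →+* B)) (σ := (σ : B →+* A)) hσ
    (fun x hx => hnil x hx) hΛ h1 hΛΛ

end WedderburnMalcev

end Literature.NumberTheory.ComplexMultiplication.FiniteQAlgebraLattice
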